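import Summits.CriticalPhenomena.PercolationContinuityZ3.Theorems.Transplant.GrigorchukLamplighterDefs
import Mathlib.Algebra.Group.Subgroup.Pointwise
import Mathlib.GroupTheory.OrderOfElement
import Mathlib.Tactic.Group
import HarnessLib

/-!
# ALTERNATING NORMAL FORMS for the first Grigorchuk group: the relations `a² = b² = c² = d² = 1`, `bc = cb = d` (the Klein group `{1, b, c, d}`) recovered from the
# closed-form generators; the forms `[a] (x₁ a)(x₂ a)⋯(x_k a) q` (`xᵢ ∈ {b,c,d}`, `q ∈ {1,b,c,d}`), left multiplication by a generator (`push`), and: every element of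
# `𝔊` has a normal form

builds on p205010 (kernel theorem, internal audit signed; external expert review pending) — nothing in this file uses p205010; pure group theory, no percolation
statement, no node touched.  Group theory of `𝔊` (Grigorchuk 1980): file F2 of the O7 plan (`run/shared/lean/prim/bschramm/P3-NILPOTENT.md` §28.6; lead g25 rulings
2026-08-28 00:30Z), used only to discharge the binder `htor` of «GrigorchukLamplighterStandardGensNoGo» p589680 (F3 «GrigorchukTorsion» proves Grigorchuk's torsion
theorem on these normal forms).  DEFINITION LANE (review-queued): the finite types `V4`, `BCD`, `Letter`, the structure `NForm` and the functions `eval`, `len`, `wt`,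
`weight`, `push`, `nf` are definitions; every result carries a citation tag.  Lane `prim-bschramm`, seat `prim-bschramm-p3` gen 35 (DESIGN OWNER).  Helper file
(`--supports stmt-CriticalPhenomena-4575 --as helper`).  No instance beyond `deriving DecidableEq`, no notation.  NOTHING about growth; no torsion statement here.

* §1 `sectionGen_comp`: `sectionGen P ∘ sectionGen Q = sectionGen (P xor Q)` — hence the KLEIN RELATIONS `b c = d` etc. for the closed-form `genB, genC, genD`
  (`V4.toPerm_mul`: the multiplication table of `{1, b, c, d}` holds in `Perm(Ray)`).
* §2 NORMAL FORMS `NForm = (p : Bool) × (L : List BCD) × (q : V4)`, `eval N = [a]^p · Π_{x ∈ L} (x·a) · q`, `len N = [p] + 2|L| + [q ≠ 1]`, the weight `wt d = 1, wt c = 2,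
  wt b = 3` and `weight N = Σ wt` (F3's induction measure).
* §3 `push ℓ N` = the normal form of `ℓ · eval N` for a generator `ℓ ∈ {a, b, c, d}`: `eval_push`, `len_push_le` (`≤ len N + 1`), `weight_push_le`.
* §4 `nf w = foldr push 1 w` for a word `w : List Letter`: `eval_nf`, `len_nf_le`, `weight_nf_le`; **`exists_nform_of_mem`: every `g ∈ 𝔊` is `eval N` for some `N`.**
[cite: Grigorchuk1980, the generators a, b, c, d are involutions and {1, b, c, d} is a Klein group; reduced words alternate a and {b, c, d}]
[cite: BartholdiErschler2012, §3.1 (the first Grigorchuk group)]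
-/

noncomputable section

namespace Summit.CriticalPhenomena.PercolationContinuityZ3.Theorems.Transplant

namespace Grigorchuk

/-! ## §1 Composition of section generators; the Klein relations -/

/-- **Two section generators compose to the section generator of the XOR pattern** (both act, if at all, on the letter after the first `0`, which neither moves).
[cite: Grigorchuk1980, relations among b, c, d] -/
theorem sectionGen_comp (P Q : ℕ → Bool) (x : Ray) : sectionGen P (sectionGen Q x) = sectionGen (fun k => xor (P k) (Q k)) x := by
  unfold sectionGen
  by_cases h : ∃ k, x k = false
  · rw [dif_pos h, dif_pos h]
    by_cases hQ : Q (Nat.find h) = true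
    · rw [if_pos hQ]
      have h' : ∃ k, flipAt (Nat.find h + 1) x k = false :=
        ⟨Nat.find h, by rw [flipAt_apply_ne (by omega)]; exact Nat.find_spec h⟩
      rw [dif_pos h', find_flipAt_succ h h']
      by_cases hP : P (Nat.find h) = true
      · rw [if_pos hP, if_neg (by simp [hP, hQ])]; exact flipAt_involutive _ x
      · rw [if_neg hP, if_pos (by simpa [hQ] using hP)]
    · rw [if_neg hQ, dif_pos h]
      by_cases hP : P (Nat.find h) = true
      · rw [if_pos hP, if_pos (by simpa [hP] using hQ)]
      · rw [if_neg hP, if_neg (by simp only [Bool.not_eq_true] at hP hQ; simp [hP, hQ])]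
  · simp [h]

/-- The Klein four-group `{1, b, c, d}` as a type with its multiplication table. [cite: Grigorchuk1980, {1, b, c, d} ≅ (ℤ/2)²] -/
inductive V4 | e | b | c | d
  deriving DecidableEq

/-- The three letters `b, c, d`. [cite: Grigorchuk1980, definition of b, c, d] -/
inductive BCD | b | c | d
  deriving DecidableEq

/-- The four generators `a, b, c, d` as letters. [cite: Grigorchuk1980, definition of a, b, c, d] -/
inductive Letter | a | x (v : BCD)
  deriving DecidableEq

/-- `b, c, d` inside `{1, b, c, d}`. [folklore] -/
def BCD.toV4 : BCD → V4
  | .b => .b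
  | .c => .c
  | .d => .d

/-- The permutation named by an element of `{1, b, c, d}`. [cite: Grigorchuk1980, definition of b, c, d] -/
def V4.toPerm : V4 → Equiv.Perm Ray
  | .e => 1
  | .b => genB
  | .c => genC
  | .d => genD

/-- The permutation named by a letter `b, c, d`. [cite: Grigorchuk1980, definition of b, c, d] -/
def BCD.toPerm (v : BCD) : Equiv.Perm Ray := v.toV4.toPerm

/-- The permutation named by a letter. [cite: Grigorchuk1980, definition of a, b, c, d] -/
def Letter.toPerm : Letter → Equiv.Perm Ray
  | .a => genA
  | .x v => v.toPerm

/-- The multiplication table of the Klein group `{1, b, c, d}`. [cite: Grigorchuk1980, {1, b, c, d} ≅ (ℤ/2)²] -/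
def V4.mul : V4 → V4 → V4
  | .e, v => v
  | v, .e => v
  | .b, .b => .e
  | .b, .c => .d
  | .b, .d => .c
  | .c, .b => .d
  | .c, .c => .e
  | .c, .d => .b
  | .d, .b => .c
  | .d, .c => .b
  | .d, .d => .e

/-- The pattern of an element of `{1, b, c, d}` (`1` ↦ never flip). [cite: Grigorchuk1980, definition of b, c, d] -/
def V4.pattern : V4 → ℕ → Bool
  | .e => fun _ => false
  | .b => fun k => decide (k % 3 ≠ 2)
  | .c => fun k => decide (k % 3 ≠ 1)
  | .d => fun k => decide (k % 3 ≠ 0)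

/-- `sectionGen` of the never-flip pattern is the identity. [folklore] -/
theorem sectionGen_false (x : Ray) : sectionGen (fun _ => false) x = x := by
  unfold sectionGen; by_cases h : ∃ k, x k = false
  · rw [dif_pos h, if_neg (by simp)]
  · rw [dif_neg h]

/-- Every element of `{1, b, c, d}` acts by `sectionGen` of its pattern. [cite: Grigorchuk1980, definition of b, c, d] -/
theorem V4.toPerm_apply (v : V4) (x : Ray) : v.toPerm x = sectionGen v.pattern x := by
  cases v
  · exact (sectionGen_false x).symm
  · rfl
  · rfl
  · rfl

/-- The patterns multiply by XOR according to the table. [cite: Grigorchuk1980, {1, b, c, d} ≅ (ℤ/2)²] -/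
theorem V4.pattern_mul (u v : V4) : (V4.mul u v).pattern = fun k => xor (u.pattern k) (v.pattern k) := by
  funext k
  have h3 : k % 3 = 0 ∨ k % 3 = 1 ∨ k % 3 = 2 := by omega
  cases u <;> cases v <;> rcases h3 with h | h | h <;> simp [V4.mul, V4.pattern, h]

/-- **THE KLEIN RELATIONS hold for the closed-form generators**: `toPerm (u · v) = toPerm u * toPerm v` (`b² = 1`, `b c = d`, …). [cite: Grigorchuk1980, {1, b, c, d} ≅ (ℤ/2)²] -/
theorem V4.toPerm_mul (u v : V4) : (V4.mul u v).toPerm = u.toPerm * v.toPerm := by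
  refine Equiv.ext fun x => ?_
  rw [Equiv.Perm.mul_apply, V4.toPerm_apply, V4.toPerm_apply, V4.toPerm_apply, sectionGen_comp, V4.pattern_mul]

/-- `1 ∈ {1, b, c, d}` acts trivially. [folklore] -/
@[simp] theorem V4.toPerm_e : V4.e.toPerm = 1 := rfl

/-- `a² = 1` (local copy of «GrigorchukLamplighterCriticalContinuity» `genA_mul_genA`, keeping this file's imports light). [cite: Grigorchuk1980, a is an involution] -/
private theorem genA_sq : genA * genA = 1 := Equiv.ext fun x => flipAt_involutive 0 x

/-- The generators lie in `𝔊`. [cite: Grigorchuk1980, definition of the group] -/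
theorem Letter.toPerm_mem (ℓ : Letter) : ℓ.toPerm ∈ grigorchukGroup := by
  rcases ℓ with _ | ⟨_ | _ | _⟩ <;> exact Subgroup.subset_closure (by simp [Letter.toPerm, BCD.toPerm, BCD.toV4, V4.toPerm])

/-- Elements of `{1, b, c, d}` lie in `𝔊`. [cite: Grigorchuk1980, definition of the group] -/
theorem V4.toPerm_mem (v : V4) : v.toPerm ∈ grigorchukGroup := by
  rcases v with _ | _ | _ | _
  · exact grigorchukGroup.one_mem
  · exact Letter.toPerm_mem (.x .b)
  · exact Letter.toPerm_mem (.x .c)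
  · exact Letter.toPerm_mem (.x .d)

/-! ## §2 Normal forms -/

/-- **An alternating normal form** `[a]^p · (x₁ a)(x₂ a)⋯(x_k a) · q`: an optional leading `a`, a list of letters `xᵢ ∈ {b, c, d}` each followed by `a`, and a final
`q ∈ {1, b, c, d}`. [cite: Grigorchuk1980, reduced words alternate a and {b, c, d}] -/
structure NForm where
  /-- leading `a` present -/
  p : Bool
  /-- the letters `x₁, …, x_k` of the blocks `xᵢ a` -/
  L : List BCD
  /-- the final Klein letter -/
  q : V4

/-- The product of the blocks `(x₁ a)(x₂ a)⋯(x_k a)`. [cite: Grigorchuk1980, reduced words] -/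
def blocks (L : List BCD) : Equiv.Perm Ray := (L.map fun x => x.toPerm * genA).prod

/-- The group element of a normal form. [cite: Grigorchuk1980, reduced words] -/
def NForm.eval (N : NForm) : Equiv.Perm Ray := (if N.p then genA else 1) * blocks N.L * N.q.toPerm

/-- The length of a normal form (number of letters). [cite: Grigorchuk1980, word length] -/
def NForm.len (N : NForm) : ℕ := (if N.p then 1 else 0) + 2 * N.L.length + (if N.q = .e then 0 else 1)

/-- The weight of a Klein letter: the number of levels before it disappears under sections (`d ↦ (1, b)` at once, `c ↦ (a, d)`, `b ↦ (a, c)`). (Lane bookkeeping for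
F3's induction.) [folklore] -/
def V4.wt : V4 → ℕ
  | .e => 0
  | .d => 1
  | .c => 2
  | .b => 3

/-- The total weight of a normal form. [folklore] -/
def NForm.weight (N : NForm) : ℕ := (N.L.map fun x => x.toV4.wt).sum + N.q.wt

/-- `blocks [] = 1`. [folklore] -/
@[simp] theorem blocks_nil : blocks [] = 1 := rfl

/-- `blocks (x :: L) = x a · blocks L`. [folklore] -/
@[simp] theorem blocks_cons (x : BCD) (L : List BCD) : blocks (x :: L) = x.toPerm * genA * blocks L := by
  simp [blocks]

/-- `blocks (L ++ L') = blocks L · blocks L'`. [folklore] -/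
theorem blocks_append (L L' : List BCD) : blocks (L ++ L') = blocks L * blocks L' := by
  simp [blocks, List.map_append, List.prod_append]

/-- The normal form `1`. [folklore] -/
def NForm.one : NForm := ⟨false, [], .e⟩

/-- `eval 1 = 1`. [folklore] -/
@[simp] theorem NForm.eval_one : NForm.one.eval = 1 := by simp [NForm.one, NForm.eval]

/-- `len 1 = 0`. [folklore] -/
@[simp] theorem NForm.len_one : NForm.one.len = 0 := by simp [NForm.one, NForm.len]

/-- The value of a normal form lies in `𝔊`. [cite: Grigorchuk1980, definition of the group] -/
theorem NForm.eval_mem (N : NForm) : N.eval ∈ grigorchukGroup := by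
  have ha : genA ∈ grigorchukGroup := Letter.toPerm_mem .a
  have hb : ∀ L : List BCD, blocks L ∈ grigorchukGroup := by
    intro L; induction L with
    | nil => exact grigorchukGroup.one_mem
    | cons x L ih => rw [blocks_cons]; exact grigorchukGroup.mul_mem (grigorchukGroup.mul_mem (Letter.toPerm_mem (.x x)) ha) ih
  unfold NForm.eval
  refine grigorchukGroup.mul_mem (grigorchukGroup.mul_mem ?_ (hb _)) (V4.toPerm_mem _)
  split_ifs
  · exact ha
  · exact grigorchukGroup.one_mem

/-! ## §3 Left multiplication by a generator -/

/-- **`push ℓ N`: the normal form of `ℓ · eval N`** for a generator `ℓ` — `a` toggles the leading `a`; a Klein letter `x` either opens a new block `x a` (if a leading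
`a` is present), or merges with the first block's letter (`x x₁ = 1` deletes the block and exposes its `a`; otherwise the letter is replaced), or, if there is no block,
merges with the final Klein letter. [cite: Grigorchuk1980, reduction of words using a² = 1 and the Klein relations] -/
def push : Letter → NForm → NForm
  | .a, N => ⟨!N.p, N.L, N.q⟩
  | .x v, ⟨true, L, q⟩ => ⟨false, v :: L, q⟩
  | .x v, ⟨false, [], q⟩ => ⟨false, [], V4.mul v.toV4 q⟩
  | .x v, ⟨false, x₁ :: L, q⟩ =>
      match V4.mul v.toV4 x₁.toV4 with
      | .e => ⟨true, L, q⟩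
      | .b => ⟨false, .b :: L, q⟩
      | .c => ⟨false, .c :: L, q⟩
      | .d => ⟨false, .d :: L, q⟩

/-- **`eval (push ℓ N) = ℓ · eval N`.** [cite: Grigorchuk1980, reduction of words] -/
theorem eval_push (ℓ : Letter) (N : NForm) : (push ℓ N).eval = ℓ.toPerm * N.eval := by
  rcases ℓ with _ | v
  · -- `a`: toggle
    rcases N with ⟨p, L, q⟩
    cases p <;> simp [push, NForm.eval, Letter.toPerm, ← mul_assoc, genA_sq]
  · rcases N with ⟨p, L, q⟩
    cases p with
    | true => simp [push, NForm.eval, Letter.toPerm, BCD.toPerm, mul_assoc]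
    | false =>
      cases L with
      | nil => simp [push, NForm.eval, Letter.toPerm, BCD.toPerm, V4.toPerm_mul]
      | cons x₁ L =>
        have key : ∀ u : V4, V4.mul v.toV4 x₁.toV4 = u →
            v.toPerm * (x₁.toPerm * genA * blocks L * q.toPerm) = u.toPerm * genA * blocks L * q.toPerm := by
          intro u hu; rw [← hu, V4.toPerm_mul, BCD.toPerm, BCD.toPerm]; simp only [mul_assoc]
        have hR : NForm.eval ⟨false, x₁ :: L, q⟩ = x₁.toPerm * genA * blocks L * q.toPerm := by
          simp [NForm.eval]
        rw [hR, Letter.toPerm, key _ rfl]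
        simp only [push]
        split <;> rename_i heq <;> rw [heq] <;> simp [NForm.eval, V4.toPerm, BCD.toPerm, BCD.toV4, mul_assoc]

/-- **`len (push ℓ N) ≤ len N + 1`.** [cite: Grigorchuk1980, word length] -/
theorem len_push_le (ℓ : Letter) (N : NForm) : (push ℓ N).len ≤ N.len + 1 := by
  rcases ℓ with _ | v
  · rcases N with ⟨p, L, q⟩; cases p <;> simp [push, NForm.len] <;> omega
  · rcases N with ⟨p, L, q⟩
    cases p with
    | true => simp [push, NForm.len]; split_ifs <;> omega
    | false =>
      cases L with
      | nil => simp only [push, NForm.len]; split_ifs <;> simp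
      | cons x₁ L =>
        simp only [push]
        split <;> simp [NForm.len]
        omega

/-- Weights of products in the Klein group are subadditive. [folklore] -/
theorem V4.wt_mul_le (u v : V4) : (V4.mul u v).wt ≤ u.wt + v.wt := by
  cases u <;> cases v <;> decide

/-- The weight of a letter as an element of the Klein group. [folklore] -/
theorem BCD.wt_toV4_pos (v : BCD) : 1 ≤ v.toV4.wt := by cases v <;> decide

/-- **`weight (push ℓ N) ≤ weight N + wt ℓ`** (`wt a = 0`). [folklore] -/
theorem weight_push_le (ℓ : Letter) (N : NForm) :
    (push ℓ N).weight ≤ N.weight + (match ℓ with | .a => 0 | .x v => v.toV4.wt) := by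
  rcases ℓ with _ | v
  · rcases N with ⟨p, L, q⟩; cases p <;> simp [push, NForm.weight]
  · rcases N with ⟨p, L, q⟩
    cases p with
    | true => simp [push, NForm.weight]; omega
    | false =>
      cases L with
      | nil => simp only [push, NForm.weight, List.map_nil, List.sum_nil, zero_add]; have := V4.wt_mul_le v.toV4 q; omega
      | cons x₁ L =>
        have hm := V4.wt_mul_le v.toV4 x₁.toV4
        simp only [push]
        split <;> rename_i heq <;> rw [heq] at hm <;> simp [NForm.weight, BCD.toV4, V4.wt] at hm ⊢ <;> omega

/-! ## §4 The normal form of a word; every element of `𝔊` has a normal form -/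

/-- The normal form of a word in the generators (letters multiplied on the left of `1`). [cite: Grigorchuk1980, reduced words] -/
def nf (w : List Letter) : NForm := w.foldr push NForm.one

/-- `nf [] = 1`. [folklore] -/
@[simp] theorem nf_nil : nf [] = NForm.one := rfl

/-- `nf (ℓ :: w) = push ℓ (nf w)`. [folklore] -/
@[simp] theorem nf_cons (ℓ : Letter) (w : List Letter) : nf (ℓ :: w) = push ℓ (nf w) := rfl

/-- **`eval (nf w) = Π w`**: the normal form evaluates to the word. [cite: Grigorchuk1980, reduced words] -/
theorem eval_nf (w : List Letter) : (nf w).eval = (w.map Letter.toPerm).prod := by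
  induction w with
  | nil => simp
  | cons ℓ w ih => rw [nf_cons, eval_push, ih, List.map_cons, List.prod_cons]

/-- **`len (nf w) ≤ |w|`.** [cite: Grigorchuk1980, word length] -/
theorem len_nf_le (w : List Letter) : (nf w).len ≤ w.length := by
  induction w with
  | nil => simp
  | cons ℓ w ih => rw [nf_cons, List.length_cons]; exact (len_push_le ℓ _).trans (by omega)

/-- The total weight of a word (`wt a = 0`). [folklore] -/
def wordWeight (w : List Letter) : ℕ := (w.map fun ℓ => match ℓ with | .a => 0 | .x v => v.toV4.wt).sum

/-- **`weight (nf w) ≤` the total weight of `w`.** [folklore] -/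
theorem weight_nf_le (w : List Letter) : (nf w).weight ≤ wordWeight w := by
  induction w with
  | nil => simp [nf, NForm.one, NForm.weight, wordWeight, V4.wt]
  | cons ℓ w ih =>
    rw [nf_cons]
    refine (weight_push_le ℓ _).trans ?_
    rcases ℓ with _ | v <;> simp [wordWeight] at ih ⊢ <;> omega

/-- **Every element of `𝔊` has a normal form.** [cite: Grigorchuk1980, every element is a reduced word in a, b, c, d] -/
theorem exists_nform_of_mem {g : Equiv.Perm Ray} (hg : g ∈ grigorchukGroup) : ∃ N : NForm, N.eval = g := by
  induction hg using Subgroup.closure_induction_left with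
  | one => exact ⟨NForm.one, NForm.eval_one⟩
  | mul_left x hx y _ ih =>
    obtain ⟨N, hN⟩ := ih
    simp only [Set.mem_insert_iff, Set.mem_singleton_iff] at hx
    rcases hx with rfl | rfl | rfl | rfl
    · exact ⟨push .a N, by rw [eval_push, hN]; rfl⟩
    · exact ⟨push (.x .b) N, by rw [eval_push, hN]; rfl⟩
    · exact ⟨push (.x .c) N, by rw [eval_push, hN]; rfl⟩
    · exact ⟨push (.x .d) N, by rw [eval_push, hN]; rfl⟩
  | inv_mul_cancel x hx y _ ih =>
    obtain ⟨N, hN⟩ := ih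
    -- the generators are involutions
    have hinv : x⁻¹ = x := by
      simp only [Set.mem_insert_iff, Set.mem_singleton_iff] at hx
      rcases hx with rfl | rfl | rfl | rfl
      · exact inv_eq_of_mul_eq_one_right genA_sq
      · exact inv_eq_of_mul_eq_one_right (by simpa [V4.mul, V4.toPerm] using (V4.toPerm_mul V4.b V4.b).symm)
      · exact inv_eq_of_mul_eq_one_right (by simpa [V4.mul, V4.toPerm] using (V4.toPerm_mul V4.c V4.c).symm)
      · exact inv_eq_of_mul_eq_one_right (by simpa [V4.mul, V4.toPerm] using (V4.toPerm_mul V4.d V4.d).symm)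
    rw [hinv]
    simp only [Set.mem_insert_iff, Set.mem_singleton_iff] at hx
    rcases hx with rfl | rfl | rfl | rfl
    · exact ⟨push .a N, by rw [eval_push, hN]; rfl⟩
    · exact ⟨push (.x .b) N, by rw [eval_push, hN]; rfl⟩
    · exact ⟨push (.x .c) N, by rw [eval_push, hN]; rfl⟩
    · exact ⟨push (.x .d) N, by rw [eval_push, hN]; rfl⟩

end Grigorchuk

end Summit.CriticalPhenomena.PercolationContinuityZ3.Theorems.Transplant

end
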